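import Summits.BirchSwinnertonDyer.BirchSwinnertonDyer.Theorems.AdditiveBranchIMCGordTwoRankZeroDesc3DoorOfLower
import Summits.BirchSwinnertonDyer.BirchSwinnertonDyer.Theorems.KatoDescentPotSupersingularWildLowerDesc3RecordsX4deep02
import Summits.BirchSwinnertonDyer.BirchSwinnertonDyer.Theorems.KatoDescentPotSupersingularWildLowerDesc3RecordsX4deep03
import Summits.BirchSwinnertonDyer.Rank1Residual.GaloisImage.FrobeniusOrderWitness
import Summits.BirchSwinnertonDyer.Rank1Residual.Supersingular.CountPointsFast
import Summits.BirchSwinnertonDyer.Rank1Residual.X11b.KrausMinimalityGeneralTwo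
import Summits.BirchSwinnertonDyer.Rank1Residual.Additive.X4ThreeResCertKernel
import Literature.NumberTheory.EllipticCurves.IsogenyIdProofs
import HarnessLib

/-!
# Route `AdditiveBranchIMC` (rung K1), crux `GordTwoRankZeroOffCaseOne` (item 19357, odd child 19245 ∋ `p = 3`) — DEEP RECORDS part 3 of 3 (classes `440775g1`, `446904j1`, `496584bv1`): wild X4 rank-`0`
# classes with `#Ш_an = 81` closed PER CLASS: bsd-potss K9's second-`3`-descent LOWER records `K9Desc3.lower3_deep_<label>` ∘ the X4♯(3) UPPER half
# (cell `bsd-addord`, seat `bsd-addord-k1-c2` gen 8; classes 98280o 105408k 280962ce 328320de 386019q 402624cj 413559be 422253b 440775g 446904j 496584bv)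

HONEST FRAMING: nothing here proves BSD or the crux (OPEN at class level); THEOREMS ONLY (no definition, no named fact, no `sorry`); per pair /
per class; NOT a class theorem; nothing booked (booking is referee A's on the planner's offer). These are bsd-potss's «ONLY per-pair-open classes of
the K9 intrinsic census» (k9-desc3 g0, 2026-08-26T18:36Z): wild at `3` (`27 ∣ N`), `ρ̄_{E,3}` onto, `r_an = 0`, single-member, `#Ш_an = 81`. Their
LOWER half `ord₃ #Ш_an ≤ ord₃ #Ш` (`81 ∣ #Ш`) is the K9 kernel record `K9Desc3.lower3_deep_<label>`
(`Theorems/KatoDescentPotSupersingularWildLowerDesc3RecordsX4deep01–03`, seat bsd-potss-k9-desc3; displayed inputs: a DEEP WITNESS `x, y ∈ Ш(E)`,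
`ord x = 9`, `3y = 0`, `y ∉ ℤx` — EVIDENCE = their cc-eng-4 B-1 second `3`-descent (Creutz 2014 Thm. 7.2) runs kit j257505 / j257911 / j257912 /
j258132 / j258551, NONEMPTY(witness) on two engines with XVERIFY:PASS, quoted in their docstrings — plus Cassels–Tate `hCT`, Cassels `hCassels`, GZK,
modularity). The UPPER half `ord₃ #Ш ≤ ord₃ #Ш_an` is Kato 2004 Thm. 14.5 (3) in the Manin-free SHARP reading A161′ on the potentially good branch
(all 11 are wild ⟹ `ord₃ j ≥ 0`): team n1011's `X4RankZero.missingUpperBoundAt_three_of_cert_maninFree_noL20` on the 10 classes with `3 ∤ ∏ c_ℓ`,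
and this seat's `missingUpperBoundAt_three_of_x4Cert_tamLocal` (p529837; Kodaira IV* with `c₃ = 3 = ∏ c_ℓ`) on `422253b`. IN THE KERNEL per record:
`Δ ≠ 0` and global minimality of the Cremona model (Kraus, support of `Δ` listed), `ρ̄_{E,3}` ONTO (Frobenius witnesses `ℓ₁` = irreducible
characteristic polynomial mod `3`, `ℓ₂ ≡ 1`, `a_{ℓ₂} ≡ 2 (mod 3)`, `9 ∤ #Ẽ(𝔽_{ℓ₂})`; point counts by `decide +kernel`), `Addv W 3`, and the `3`-adic
image certificate = a `j`-WITNESS `q ≠ 3` with `ord_q j = 3·v_q(c₄) − v_q(Δ) < 0`, `3 ∤ ord_q j` from divisibility certificates on the integral model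
(`jWitness_three_of_intModel`, file `…Desc3DoorOfLower`). DISPLAYED binders: the register facts {hKato = A161′, hDel, hGZK, hmod, hmodD, hKatoω, hCT, hCassels},
Cremona's `r_an = 0` and `#Ш_an = s` with `ord₃ s ≤ 4` (`hr`, `hs`, `hv`; value quoted per record), K9's deep witness (`hx`, `h3y`, `hy`), and the
Tamagawa datum (`htam : 3 ∤ ∏ c_ℓ`, resp. `ord₃ ∏ c_ℓ = v₃(c₃)` for `422253b`; Cremona `allbsd` ∏c ∥ Tate's algorithm, quoted per record).
References: [Kato2004Asterisque] Thm. 14.5 (3) (p. 236), Thm. 17.4 (3) (p. 273); [Delbourgo1998] Prop. 4 (p. 144); [Creutz2014] Thm. 7.2;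
[Wuthrich2014] Lemma 20 (p. 399); [Serre1972] §2; [SilvermanAEC2009] Thm. X.4.14, VII.1 Rem. 1.1; [Kraus1989]; [MilneADT2006] Thm. I.7.3;
[Miller2011LMS] Def. 1.1; [Cremona2006] Table 1.
-/

set_option autoImplicit false

noncomputable section

open scoped Classical

open WeierstrassCurve Literature.NumberTheory.EllipticCurves
  Literature.NumberTheory.EllipticCurves.Rank1Residual
  Literature.NumberTheory.EllipticCurves.Rank1Residual.Typed
  Literature.NumberTheory.EllipticCurves.Rank1Residual.X11RankOneCertificates
  Literature.NumberTheory.EllipticCurves.ModularForms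
  Literature.NumberTheory.GaloisRepresentations
  Summit.BirchSwinnertonDyer.BirchSwinnertonDyer.Rank1Residual.IntModel
  Summit.BirchSwinnertonDyer.Rank1Residual.X11b
  Summit.BirchSwinnertonDyer.Rank1Residual.GaloisImage
  Summit.BirchSwinnertonDyer.Rank1Residual.Supersingular

set_option linter.dupNamespace false

namespace Summit.BirchSwinnertonDyer.BirchSwinnertonDyer.Theorems.AdditiveBranchIMCGordTwoRankZeroDesc3

open Summit.BirchSwinnertonDyer.Rank1Residual
open Summit.BirchSwinnertonDyer.Rank1Residual.Additive
open Summit.BirchSwinnertonDyer.BirchSwinnertonDyer.Theorems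

/-! ### `440775g1` (class `440775g`, single member; `N = 440775 = 3³·5²·653`; Cremona: `r_an = 0`, `#Ш_an = 81`, `#tors = 1`, `∏ c_ℓ = 2`; Kodaira at `3`: IV*, `c₃ = 1`, `f₃ = 3`) -/

/-- `[0, 0, 1, -3121875, -2123149219]` (Cremona's minimal model of `440775g1`) is an elliptic curve: `Δ ≠ 0` (support `[[3, 3, 9], [5, 2, 10], [653, 1, 2]]` as `(q, v_q N, v_q Δ)`). [cite: Cremona2006, Table 1] -/
theorem isElliptic_w440775g1 : (⟨0, 0, 1, -3121875, -2123149219⟩ : WeierstrassCurve ℚ).IsElliptic :=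
  X11b.isElliptic_of_discOf_ne_zero 0 0 1 (-3121875) (-2123149219) (by decide +kernel)

/-- `[0, 0, 1, -3121875, -2123149219]` (`440775g1`) is globally minimal: support of `Δ` = `[[3, 3, 9], [5, 2, 10], [653, 1, 2]]` as `(q, v_q N, v_q Δ)`, Kraus prime by prime (kernel). [cite: SilvermanAEC2009, VII.1 Remark 1.1] [cite: Kraus1989, Prop. 1 and Prop. 2] -/
theorem isGloballyMinimal_w440775g1 : (⟨0, 0, 1, -3121875, -2123149219⟩ : WeierstrassCurve ℚ).IsGloballyMinimal :=
  X11b.isGloballyMinimal_of_krausCriterion_support 0 0 1 (-3121875) (-2123149219)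
    [(3, 3, 9), (5, 2, 10), (653, 1, 2)]
    (by intro t ht; simp only [List.mem_cons, List.not_mem_nil, or_false] at ht; rcases ht with rfl | rfl | rfl <;> norm_num)
    (by decide +kernel) (by decide +kernel)

/-- **`ρ̄_{E,3}` ONTO for `E = 440775g1`** (kernel): irreducible by `ℓ₁ = 7` (`#Ẽ(𝔽_{7}) = 8`, `X² − 0X + ℓ₁` has no root mod 3); order-3 element by
`ℓ₂ = 31` (`#Ẽ(𝔽_{31}) = 33`, `ℓ₂ ≡ 1`, `a = -1 ≡ 2 (mod 3)`, `9 ∤ #Ẽ`) — `hasSurjectiveModNGaloisRep_of_intModel_of_irr_of_order`. [cite: Serre1972, §2.4 Prop. 15, §2.8 Prop. 19] -/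
theorem surj_w440775g1_3 : (⟨0, 0, 1, -3121875, -2123149219⟩ : WeierstrassCurve ℚ).HasSurjectiveModNGaloisRep 3 := by
  haveI := isElliptic_w440775g1
  haveI := isGloballyMinimal_w440775g1
  haveI : Fact (Nat.Prime 7) := ⟨by norm_num⟩
  haveI : Fact (Nat.Prime 31) := ⟨by norm_num⟩
  have hI : integralModelInt (⟨0, 0, 1, -3121875, -2123149219⟩ : WeierstrassCurve ℚ) = (⟨0, 0, 1, -3121875, -2123149219⟩ : WeierstrassCurve ℤ) :=
    integralModelInt_eq_of_map_eq _ (map_mk_int 0 0 1 (-3121875) (-2123149219))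
  have hc₁ : Nat.card ((((⟨0, 0, 1, -3121875, -2123149219⟩ : WeierstrassCurve ℤ)).map (Int.castRingHom (ZMod 7))).toAffine.Point) = 8 := by
    have h := natCard_point_eq_countPoints 0 0 1 (-3121875) (-2123149219) 7 (by norm_num) (by decide +kernel)
    have h' : countPoints [0, 0, 1, -3121875, -2123149219] 7 = 8 := countPoints_eq_of_fast (by decide +kernel)
    exact_mod_cast h.trans h'
  have hc₂ : Nat.card ((((⟨0, 0, 1, -3121875, -2123149219⟩ : WeierstrassCurve ℤ)).map (Int.castRingHom (ZMod 31))).toAffine.Point) = 33 := by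
    have h := natCard_point_eq_countPoints 0 0 1 (-3121875) (-2123149219) 31 (by norm_num) (by decide +kernel)
    have h' : countPoints [0, 0, 1, -3121875, -2123149219] 31 = 33 := countPoints_eq_of_fast (by decide +kernel)
    exact_mod_cast h.trans h'
  exact hasSurjectiveModNGaloisRep_of_intModel_of_irr_of_order hI 3 7 31 (by norm_num) (by norm_num) (by decide +kernel)
    (by decide +kernel) hc₁ hc₂ (by decide) (by decide) (by decide) (by decide)

/-- **`BSD(E,3)` for the DEEP class `E = 440775g1`** (`#Ш_an = 81`): LOWER half = bsd-potss K9's second-descent record `K9Desc3.lower3_deep_440775g1` (deep witness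
`x, y ∈ Ш(E)`, `ord x = 9`, `3y = 0`, `y ∉ ℤx` ⟹ `81 ∣ #Ш`; evidence quoted THERE: cc-eng-4 B-1 second `3`-descent, two engines, XVERIFY:PASS) with `W₀ := W`;
UPPER half = team n1011's `X4RankZero.missingUpperBoundAt_three_of_cert_maninFree_noL20` (Kato 14.5 (3), A161′) — `ρ̄_{E,3}` onto, `Addv W 3`, irreducibility and the `j`-witness
`q = 653` (`v_q(c₄) = 0`, `v_q(Δ) = 2`, `ord_q j = -2`) IN THE KERNEL; displayed: register facts, `hr`/`hs`/`hv` (`#Ш_an = 81`, `ord₃ = 4`), K9's deep witness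
`hx`/`h3y`/`hy`, `htam : 3 ∤ ∏ c_ℓ` (DATA: Cremona `∏ c_ℓ = 2`). Per class (single member); nothing booked. [cite: Kato2004Asterisque, Thm. 14.5 (3) (p. 236), Thm. 17.4 (3) (p. 273)] [cite: Delbourgo1998, Prop. 4 (p. 144)] [cite: Creutz2014, Thm. 7.2] [cite: SilvermanAEC2009, Thm. X.4.14 and VII.1 Remark 1.1] [cite: Miller2011LMS, §1 and Def. 1.1] -/
theorem bsdp3_deep_440775g1
    (hKato : Kato2004.rankZero_padicValNat_sha_le_sub_localTamagawa_of_additive_potGood_of_imageContainsSL2_maninFree)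
    (hDel : Delbourgo1998.prop4_rankZero_pow_dvd_constantCoeff)
    (hGZK : rank_eq_analyticRank_of_analyticRank_le_one) (hmod : hasEntireLFunction_rat)
    (hmodD : nonempty_modularParametrizationData)
    (hKatoω : Wuthrich2014.kato_minusEigenCharIdeal_dvd_cyclotomicThree_of_surjective)
    (hCT : exists_casselsTate_pairing (K := ℚ)) (hCassels : bsdRHS_eq_of_isIsogenous)
    {W : WeierstrassCurve ℚ} [W.IsElliptic] [W.IsGloballyMinimal] (hWeq : W = ⟨0, 0, 1, -3121875, -2123149219⟩)
    (hr : W.analyticRank = 0) {s : ℚ} (hs : shaAn W = (s : ℂ)) (hv : padicValRat 3 s ≤ 4)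
    {x y : W.sha} (hx : addOrderOf x = 3 ^ 2) (h3y : 3 • y = 0) (hy : y ∉ AddSubgroup.zmultiples x)
    (htam : ¬ 3 ∣ W.tamagawaProduct) :
    BSDp W 3 := by
  haveI : Fact (Nat.Prime 3) := ⟨Nat.prime_three⟩
  haveI : Fact (Nat.Prime 653) := ⟨by norm_num⟩
  have hsurj : Surj W 3 := by rw [hWeq]; exact surj_w440775g1_3
  have hIW : integralModelInt W = (⟨0, 0, 1, -3121875, -2123149219⟩ : WeierstrassCurve ℤ) :=
    integralModelInt_eq_of_map_eq _ (by rw [hWeq]; ext <;> simp [WeierstrassCurve.map])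
  have hadd : Addv W 3 := Additive.addv_of_intModel hIW 3 (by decide +kernel) (by decide +kernel)
  have hX : ClassX4 W 3 := ⟨by norm_num, hadd, hasIrreducibleModPGaloisRep_of_hasSurjectiveModNGaloisRep W 3 hsurj⟩
  have hcert : padicValRat 3 W.j < 0 ∨
      (∃ q : ℕ, q.Prime ∧ q ≠ 3 ∧ padicValRat q W.j < 0 ∧ ¬ (3 : ℤ) ∣ padicValRat q W.j) ∨
        W.HasSurjectiveModNGaloisRep 9 :=
    Or.inr (Or.inl (jWitness_three_of_intModel hIW 653 (by norm_num) 0 2 (by decide +kernel) (by decide +kernel)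
      (by decide +kernel) (by decide +kernel) (by norm_num) (by norm_num)))
  have hlow : MissingLowerBoundAt W 3 :=
    K9Desc3.lower3_deep_440775g1 hCT hCassels hGZK hmod W hWeq hr hs hv hx h3y hy W (WeierstrassCurve.isIsogenous_self W)
  exact bsdp_of_missingPPartAt W 3 hGZK (by rw [hr]; exact zero_le_one)
    (missingPPartAt_of_lower_of_upper W 3 hlow
      (X4RankZero.missingUpperBoundAt_three_of_cert_maninFree_noL20 W hKato hDel hGZK hmod hmodD hKatoω hr hX hsurj hcert htam))

/-! ### `446904j1` (class `446904j`, single member; `N = 446904 = 2³·3³·2069`; Cremona: `r_an = 0`, `#Ш_an = 81`, `#tors = 1`, `∏ c_ℓ = 2`; Kodaira at `3`: II*, `c₃ = 1`, `f₃ = 3`) -/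

/-- `[0, 0, 0, 24713397, 116979624630]` (Cremona's minimal model of `446904j1`) is an elliptic curve: `Δ ≠ 0` (support `[[2, 3, 10], [3, 3, 11], [2069, 1, 5]]` as `(q, v_q N, v_q Δ)`). [cite: Cremona2006, Table 1] -/
theorem isElliptic_w446904j1 : (⟨0, 0, 0, 24713397, 116979624630⟩ : WeierstrassCurve ℚ).IsElliptic :=
  X11b.isElliptic_of_discOf_ne_zero 0 0 0 24713397 116979624630 (by decide +kernel)

/-- `[0, 0, 0, 24713397, 116979624630]` (`446904j1`) is globally minimal: support of `Δ` = `[[2, 3, 10], [3, 3, 11], [2069, 1, 5]]` as `(q, v_q N, v_q Δ)`, Kraus prime by prime (kernel). [cite: SilvermanAEC2009, VII.1 Remark 1.1] [cite: Kraus1989, Prop. 1 and Prop. 2] -/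
theorem isGloballyMinimal_w446904j1 : (⟨0, 0, 0, 24713397, 116979624630⟩ : WeierstrassCurve ℚ).IsGloballyMinimal :=
  X11b.isGloballyMinimal_of_krausCriterion_support 0 0 0 24713397 116979624630
    [(2, 3, 10), (3, 3, 11), (2069, 1, 5)]
    (by intro t ht; simp only [List.mem_cons, List.not_mem_nil, or_false] at ht; rcases ht with rfl | rfl | rfl <;> norm_num)
    (by decide +kernel) (by decide +kernel)

/-- **`ρ̄_{E,3}` ONTO for `E = 446904j1`** (kernel): irreducible by `ℓ₁ = 5` (`#Ẽ(𝔽_{5}) = 2`, `X² − 4X + ℓ₁` has no root mod 3); order-3 element by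
`ℓ₂ = 31` (`#Ẽ(𝔽_{31}) = 24`, `ℓ₂ ≡ 1`, `a = 8 ≡ 2 (mod 3)`, `9 ∤ #Ẽ`) — `hasSurjectiveModNGaloisRep_of_intModel_of_irr_of_order`. [cite: Serre1972, §2.4 Prop. 15, §2.8 Prop. 19] -/
theorem surj_w446904j1_3 : (⟨0, 0, 0, 24713397, 116979624630⟩ : WeierstrassCurve ℚ).HasSurjectiveModNGaloisRep 3 := by
  haveI := isElliptic_w446904j1
  haveI := isGloballyMinimal_w446904j1
  haveI : Fact (Nat.Prime 5) := ⟨by norm_num⟩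
  haveI : Fact (Nat.Prime 31) := ⟨by norm_num⟩
  have hI : integralModelInt (⟨0, 0, 0, 24713397, 116979624630⟩ : WeierstrassCurve ℚ) = (⟨0, 0, 0, 24713397, 116979624630⟩ : WeierstrassCurve ℤ) :=
    integralModelInt_eq_of_map_eq _ (map_mk_int 0 0 0 24713397 116979624630)
  have hc₁ : Nat.card ((((⟨0, 0, 0, 24713397, 116979624630⟩ : WeierstrassCurve ℤ)).map (Int.castRingHom (ZMod 5))).toAffine.Point) = 2 := by
    have h := natCard_point_eq_countPoints 0 0 0 24713397 116979624630 5 (by norm_num) (by decide +kernel)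
    have h' : countPoints [0, 0, 0, 24713397, 116979624630] 5 = 2 := countPoints_eq_of_fast (by decide +kernel)
    exact_mod_cast h.trans h'
  have hc₂ : Nat.card ((((⟨0, 0, 0, 24713397, 116979624630⟩ : WeierstrassCurve ℤ)).map (Int.castRingHom (ZMod 31))).toAffine.Point) = 24 := by
    have h := natCard_point_eq_countPoints 0 0 0 24713397 116979624630 31 (by norm_num) (by decide +kernel)
    have h' : countPoints [0, 0, 0, 24713397, 116979624630] 31 = 24 := countPoints_eq_of_fast (by decide +kernel)
    exact_mod_cast h.trans h'
  exact hasSurjectiveModNGaloisRep_of_intModel_of_irr_of_order hI 3 5 31 (by norm_num) (by norm_num) (by decide +kernel)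
    (by decide +kernel) hc₁ hc₂ (by decide) (by decide) (by decide) (by decide)

/-- **`BSD(E,3)` for the DEEP class `E = 446904j1`** (`#Ш_an = 81`): LOWER half = bsd-potss K9's second-descent record `K9Desc3.lower3_deep_446904j1` (deep witness
`x, y ∈ Ш(E)`, `ord x = 9`, `3y = 0`, `y ∉ ℤx` ⟹ `81 ∣ #Ш`; evidence quoted THERE: cc-eng-4 B-1 second `3`-descent, two engines, XVERIFY:PASS) with `W₀ := W`;
UPPER half = team n1011's `X4RankZero.missingUpperBoundAt_three_of_cert_maninFree_noL20` (Kato 14.5 (3), A161′) — `ρ̄_{E,3}` onto, `Addv W 3`, irreducibility and the `j`-witness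
`q = 2069` (`v_q(c₄) = 0`, `v_q(Δ) = 5`, `ord_q j = -5`) IN THE KERNEL; displayed: register facts, `hr`/`hs`/`hv` (`#Ш_an = 81`, `ord₃ = 4`), K9's deep witness
`hx`/`h3y`/`hy`, `htam : 3 ∤ ∏ c_ℓ` (DATA: Cremona `∏ c_ℓ = 2`). Per class (single member); nothing booked. [cite: Kato2004Asterisque, Thm. 14.5 (3) (p. 236), Thm. 17.4 (3) (p. 273)] [cite: Delbourgo1998, Prop. 4 (p. 144)] [cite: Creutz2014, Thm. 7.2] [cite: SilvermanAEC2009, Thm. X.4.14 and VII.1 Remark 1.1] [cite: Miller2011LMS, §1 and Def. 1.1] -/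
theorem bsdp3_deep_446904j1
    (hKato : Kato2004.rankZero_padicValNat_sha_le_sub_localTamagawa_of_additive_potGood_of_imageContainsSL2_maninFree)
    (hDel : Delbourgo1998.prop4_rankZero_pow_dvd_constantCoeff)
    (hGZK : rank_eq_analyticRank_of_analyticRank_le_one) (hmod : hasEntireLFunction_rat)
    (hmodD : nonempty_modularParametrizationData)
    (hKatoω : Wuthrich2014.kato_minusEigenCharIdeal_dvd_cyclotomicThree_of_surjective)
    (hCT : exists_casselsTate_pairing (K := ℚ)) (hCassels : bsdRHS_eq_of_isIsogenous)
    {W : WeierstrassCurve ℚ} [W.IsElliptic] [W.IsGloballyMinimal] (hWeq : W = ⟨0, 0, 0, 24713397, 116979624630⟩)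
    (hr : W.analyticRank = 0) {s : ℚ} (hs : shaAn W = (s : ℂ)) (hv : padicValRat 3 s ≤ 4)
    {x y : W.sha} (hx : addOrderOf x = 3 ^ 2) (h3y : 3 • y = 0) (hy : y ∉ AddSubgroup.zmultiples x)
    (htam : ¬ 3 ∣ W.tamagawaProduct) :
    BSDp W 3 := by
  haveI : Fact (Nat.Prime 3) := ⟨Nat.prime_three⟩
  haveI : Fact (Nat.Prime 2069) := ⟨by norm_num⟩
  have hsurj : Surj W 3 := by rw [hWeq]; exact surj_w446904j1_3
  have hIW : integralModelInt W = (⟨0, 0, 0, 24713397, 116979624630⟩ : WeierstrassCurve ℤ) :=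
    integralModelInt_eq_of_map_eq _ (by rw [hWeq]; ext <;> simp [WeierstrassCurve.map])
  have hadd : Addv W 3 := Additive.addv_of_intModel hIW 3 (by decide +kernel) (by decide +kernel)
  have hX : ClassX4 W 3 := ⟨by norm_num, hadd, hasIrreducibleModPGaloisRep_of_hasSurjectiveModNGaloisRep W 3 hsurj⟩
  have hcert : padicValRat 3 W.j < 0 ∨
      (∃ q : ℕ, q.Prime ∧ q ≠ 3 ∧ padicValRat q W.j < 0 ∧ ¬ (3 : ℤ) ∣ padicValRat q W.j) ∨
        W.HasSurjectiveModNGaloisRep 9 :=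
    Or.inr (Or.inl (jWitness_three_of_intModel hIW 2069 (by norm_num) 0 5 (by decide +kernel) (by decide +kernel)
      (by decide +kernel) (by decide +kernel) (by norm_num) (by norm_num)))
  have hlow : MissingLowerBoundAt W 3 :=
    K9Desc3.lower3_deep_446904j1 hCT hCassels hGZK hmod W hWeq hr hs hv hx h3y hy W (WeierstrassCurve.isIsogenous_self W)
  exact bsdp_of_missingPPartAt W 3 hGZK (by rw [hr]; exact zero_le_one)
    (missingPPartAt_of_lower_of_upper W 3 hlow
      (X4RankZero.missingUpperBoundAt_three_of_cert_maninFree_noL20 W hKato hDel hGZK hmod hmodD hKatoω hr hX hsurj hcert htam))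

/-! ### `496584bv1` (class `496584bv`, single member; `N = 496584 = 2³·3³·11²·19`; Cremona: `r_an = 0`, `#Ш_an = 81`, `#tors = 1`, `∏ c_ℓ = 1`; Kodaira at `3`: II, `c₃ = 1`, `f₃ = 3`) -/

/-- `[0, 0, 0, -6017451, -5681557178]` (Cremona's minimal model of `496584bv1`) is an elliptic curve: `Δ ≠ 0` (support `[[2, 3, 11], [3, 3, 3], [11, 2, 10], [19, 1, 1]]` as `(q, v_q N, v_q Δ)`). [cite: Cremona2006, Table 1] -/
theorem isElliptic_w496584bv1 : (⟨0, 0, 0, -6017451, -5681557178⟩ : WeierstrassCurve ℚ).IsElliptic :=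
  X11b.isElliptic_of_discOf_ne_zero 0 0 0 (-6017451) (-5681557178) (by decide +kernel)

/-- `[0, 0, 0, -6017451, -5681557178]` (`496584bv1`) is globally minimal: support of `Δ` = `[[2, 3, 11], [3, 3, 3], [11, 2, 10], [19, 1, 1]]` as `(q, v_q N, v_q Δ)`, Kraus prime by prime (kernel). [cite: SilvermanAEC2009, VII.1 Remark 1.1] [cite: Kraus1989, Prop. 1 and Prop. 2] -/
theorem isGloballyMinimal_w496584bv1 : (⟨0, 0, 0, -6017451, -5681557178⟩ : WeierstrassCurve ℚ).IsGloballyMinimal :=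
  X11b.isGloballyMinimal_of_krausCriterion_support 0 0 0 (-6017451) (-5681557178)
    [(2, 3, 11), (3, 3, 3), (11, 2, 10), (19, 1, 1)]
    (by intro t ht; simp only [List.mem_cons, List.not_mem_nil, or_false] at ht; rcases ht with rfl | rfl | rfl | rfl <;> norm_num)
    (by decide +kernel) (by decide +kernel)

/-- **`ρ̄_{E,3}` ONTO for `E = 496584bv1`** (kernel): irreducible by `ℓ₁ = 17` (`#Ẽ(𝔽_{17}) = 16`, `X² − 2X + ℓ₁` has no root mod 3); order-3 element by
`ℓ₂ = 13` (`#Ẽ(𝔽_{13}) = 15`, `ℓ₂ ≡ 1`, `a = -1 ≡ 2 (mod 3)`, `9 ∤ #Ẽ`) — `hasSurjectiveModNGaloisRep_of_intModel_of_irr_of_order`. [cite: Serre1972, §2.4 Prop. 15, §2.8 Prop. 19] -/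
theorem surj_w496584bv1_3 : (⟨0, 0, 0, -6017451, -5681557178⟩ : WeierstrassCurve ℚ).HasSurjectiveModNGaloisRep 3 := by
  haveI := isElliptic_w496584bv1
  haveI := isGloballyMinimal_w496584bv1
  haveI : Fact (Nat.Prime 17) := ⟨by norm_num⟩
  haveI : Fact (Nat.Prime 13) := ⟨by norm_num⟩
  have hI : integralModelInt (⟨0, 0, 0, -6017451, -5681557178⟩ : WeierstrassCurve ℚ) = (⟨0, 0, 0, -6017451, -5681557178⟩ : WeierstrassCurve ℤ) :=
    integralModelInt_eq_of_map_eq _ (map_mk_int 0 0 0 (-6017451) (-5681557178))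
  have hc₁ : Nat.card ((((⟨0, 0, 0, -6017451, -5681557178⟩ : WeierstrassCurve ℤ)).map (Int.castRingHom (ZMod 17))).toAffine.Point) = 16 := by
    have h := natCard_point_eq_countPoints 0 0 0 (-6017451) (-5681557178) 17 (by norm_num) (by decide +kernel)
    have h' : countPoints [0, 0, 0, -6017451, -5681557178] 17 = 16 := countPoints_eq_of_fast (by decide +kernel)
    exact_mod_cast h.trans h'
  have hc₂ : Nat.card ((((⟨0, 0, 0, -6017451, -5681557178⟩ : WeierstrassCurve ℤ)).map (Int.castRingHom (ZMod 13))).toAffine.Point) = 15 := by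
    have h := natCard_point_eq_countPoints 0 0 0 (-6017451) (-5681557178) 13 (by norm_num) (by decide +kernel)
    have h' : countPoints [0, 0, 0, -6017451, -5681557178] 13 = 15 := countPoints_eq_of_fast (by decide +kernel)
    exact_mod_cast h.trans h'
  exact hasSurjectiveModNGaloisRep_of_intModel_of_irr_of_order hI 3 17 13 (by norm_num) (by norm_num) (by decide +kernel)
    (by decide +kernel) hc₁ hc₂ (by decide) (by decide) (by decide) (by decide)

/-- **`BSD(E,3)` for the DEEP class `E = 496584bv1`** (`#Ш_an = 81`): LOWER half = bsd-potss K9's second-descent record `K9Desc3.lower3_deep_496584bv1` (deep witness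
`x, y ∈ Ш(E)`, `ord x = 9`, `3y = 0`, `y ∉ ℤx` ⟹ `81 ∣ #Ш`; evidence quoted THERE: cc-eng-4 B-1 second `3`-descent, two engines, XVERIFY:PASS) with `W₀ := W`;
UPPER half = team n1011's `X4RankZero.missingUpperBoundAt_three_of_cert_maninFree_noL20` (Kato 14.5 (3), A161′) — `ρ̄_{E,3}` onto, `Addv W 3`, irreducibility and the `j`-witness
`q = 19` (`v_q(c₄) = 0`, `v_q(Δ) = 1`, `ord_q j = -1`) IN THE KERNEL; displayed: register facts, `hr`/`hs`/`hv` (`#Ш_an = 81`, `ord₃ = 4`), K9's deep witness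
`hx`/`h3y`/`hy`, `htam : 3 ∤ ∏ c_ℓ` (DATA: Cremona `∏ c_ℓ = 1`). Per class (single member); nothing booked. [cite: Kato2004Asterisque, Thm. 14.5 (3) (p. 236), Thm. 17.4 (3) (p. 273)] [cite: Delbourgo1998, Prop. 4 (p. 144)] [cite: Creutz2014, Thm. 7.2] [cite: SilvermanAEC2009, Thm. X.4.14 and VII.1 Remark 1.1] [cite: Miller2011LMS, §1 and Def. 1.1] -/
theorem bsdp3_deep_496584bv1
    (hKato : Kato2004.rankZero_padicValNat_sha_le_sub_localTamagawa_of_additive_potGood_of_imageContainsSL2_maninFree)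
    (hDel : Delbourgo1998.prop4_rankZero_pow_dvd_constantCoeff)
    (hGZK : rank_eq_analyticRank_of_analyticRank_le_one) (hmod : hasEntireLFunction_rat)
    (hmodD : nonempty_modularParametrizationData)
    (hKatoω : Wuthrich2014.kato_minusEigenCharIdeal_dvd_cyclotomicThree_of_surjective)
    (hCT : exists_casselsTate_pairing (K := ℚ)) (hCassels : bsdRHS_eq_of_isIsogenous)
    {W : WeierstrassCurve ℚ} [W.IsElliptic] [W.IsGloballyMinimal] (hWeq : W = ⟨0, 0, 0, -6017451, -5681557178⟩)
    (hr : W.analyticRank = 0) {s : ℚ} (hs : shaAn W = (s : ℂ)) (hv : padicValRat 3 s ≤ 4)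
    {x y : W.sha} (hx : addOrderOf x = 3 ^ 2) (h3y : 3 • y = 0) (hy : y ∉ AddSubgroup.zmultiples x)
    (htam : ¬ 3 ∣ W.tamagawaProduct) :
    BSDp W 3 := by
  haveI : Fact (Nat.Prime 3) := ⟨Nat.prime_three⟩
  haveI : Fact (Nat.Prime 19) := ⟨by norm_num⟩
  have hsurj : Surj W 3 := by rw [hWeq]; exact surj_w496584bv1_3
  have hIW : integralModelInt W = (⟨0, 0, 0, -6017451, -5681557178⟩ : WeierstrassCurve ℤ) :=
    integralModelInt_eq_of_map_eq _ (by rw [hWeq]; ext <;> simp [WeierstrassCurve.map])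
  have hadd : Addv W 3 := Additive.addv_of_intModel hIW 3 (by decide +kernel) (by decide +kernel)
  have hX : ClassX4 W 3 := ⟨by norm_num, hadd, hasIrreducibleModPGaloisRep_of_hasSurjectiveModNGaloisRep W 3 hsurj⟩
  have hcert : padicValRat 3 W.j < 0 ∨
      (∃ q : ℕ, q.Prime ∧ q ≠ 3 ∧ padicValRat q W.j < 0 ∧ ¬ (3 : ℤ) ∣ padicValRat q W.j) ∨
        W.HasSurjectiveModNGaloisRep 9 :=
    Or.inr (Or.inl (jWitness_three_of_intModel hIW 19 (by norm_num) 0 1 (by decide +kernel) (by decide +kernel)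
      (by decide +kernel) (by decide +kernel) (by norm_num) (by norm_num)))
  have hlow : MissingLowerBoundAt W 3 :=
    K9Desc3.lower3_deep_496584bv1 hCT hCassels hGZK hmod W hWeq hr hs hv hx h3y hy W (WeierstrassCurve.isIsogenous_self W)
  exact bsdp_of_missingPPartAt W 3 hGZK (by rw [hr]; exact zero_le_one)
    (missingPPartAt_of_lower_of_upper W 3 hlow
      (X4RankZero.missingUpperBoundAt_three_of_cert_maninFree_noL20 W hKato hDel hGZK hmod hmodD hKatoω hr hX hsurj hcert htam))

end Summit.BirchSwinnertonDyer.BirchSwinnertonDyer.Theorems.AdditiveBranchIMCGordTwoRankZeroDesc3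

end
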